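import Summits.QuantumFields.YangMills.Theorems.FluctuationComparisonRegPrIntLS2BetaLocalOfSupTower
import HarnessLib

/-!
# S2β · AVG₂♭-ax_q, THE SUP CHAIN (UV3-NODE §94), FILE 3 — THE LIFT-RECURSION KNIT: the sup tower budget (ST) (✓p829725's `hSTL`, the pairing lane's last analytic letter) FROM
# a top-stage ladder bound (TOP-LAD), a per-level lift-plus-ladder recursion (LIFT-LAD) with contraction `A·L ≤ ½`, and an `L^t`-weighted additive budget (SCT-c) — §94.5 BY KERNEL,
# with the three analytic letters ABSTRACTED to per-level real inequalities so that their holders discharge them in their own currencies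

Cell `ym3-torus` (YM ladder rung R3 = continuum `SU(2)` Yang–Mills on the three-torus at fixed lattice data — a RUNG: NOT d = 4, NOT infinite volume, NOT a mass gap,
NOT Clay).  Width seat «width 17» `ym3-torus-px17` (gen 22); crux `stmt-QuantumFields-20520` (`…Theses.UnitScaleTilt.FluctuationComparisonRegPrIntL`), LINE g18-1 S2β.
By kernel so far: GAP♯∘ ⟸ {h3, (D-stage)×2, LOC} (px16 g22 ✓`…GapOrbitAtStageAxial`), LOC ⟸ (ST) (✓p829725 `loc_of_supTowerLetter`).  THIS FILE: (ST) ⟸ LIFT-LADDER.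
`--kind proof --supports stmt-QuantumFields-20520 --as helper`, count-neutral, DEFINITION-FREE (0 `def`, 0 `instance`, 0 `notation`, 0 `sorry`).

THE ARCHITECTURE (UV3-NODE §94.5).  Name the (ST) summands `a_t := Σ_{B : PBond (F.P J) 0} ‖log η⁽ᴶ⁺ᵗ⁺¹⁾|_{READ_t(B)}‖²_∞` (`t < K − J`; the Pi-sup of the truncated log-chord field,
text VERBATIM from ✓p829725).  In the common `AxStage` gauge (✓p828013 §1) a level-`(J+t+1)` chord is, on tree-comb bonds, the LIFTED level-`(J+t)` chord (✓p828327
`stageChord_treeComb_eq_liftChord`; `= 1` at the top level `J+1`, `stageChord_treeComb_top`), and on live bonds a relative LADDER holonomy (px5 g23 Q11a, px16 ✓p828102); so with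
the hat lift's sup contraction and a per-level «ladder∕curl part» `c_t` (the supplier's choice of read set and currency):
  (TOP-LAD) `a₀ ≤ c₀`;   (LIFT-LAD) `a_{t+1} ≤ A·a_t + c_{t+1}` with `0 ≤ A`, `A·L ≤ ½`;   (SCT-c) `Σ_{t<K−J} L^t·c_t ≤ C_c·e^{c_c·Σθ}·(N⁻¹d² + N·REL)`
⟹ (ST) with `C_ST := 2·C_c`, `c_ST := c_c` — a one-line geometric absorption (`Σ L^t a_t ≤ Σ L^t c_t + A·L·Σ L^t a_t`).

WHAT IS PROVED (sorry-free).
§1 ★`weighted_sum_le_of_recursion` — the real-sequence lemma (`Finset.sum_range_succ'` shift; no tower induction).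
§2 ★★★`supTower_of_liftLadder` — (ST) AT FIXED DATA (text = ✓p829725 `local_of_supTower`'s `hST`) from (TOP-LAD) ∧ (LIFT-LAD) ∧ (SCT-c) at that data, for an ARBITRARY `c : ℕ → ℝ`.
§3 ★★★`supTowerLetter_of_liftLadderLetter (G) (Ax) (hLL)` — ✓p829725's `hSTL` VERBATIM from ONE bundled letter LIFT-LADDER in LOC's own prefix
   («`∀ L > 1, ∃ A ≥ 0, A·L ≤ ½ ∧ ∃ C_c ≥ 0, ∃ c_c ≥ 0, ∀ ⟨LOC's prefix⟩, ∃ c : ℕ → ℝ, (TOP-LAD) ∧ (LIFT-LAD) ∧ (SCT-c)`»); hence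
   `loc_of_supTowerLetter G Ax (supTowerLetter_of_liftLadderLetter G Ax hLL)` : LOC, and GAP♯∘'s last letter = LIFT-LADDER by kernel.
PENS for the three abstract letters (bus 16:54–17:26Z): (TOP-LAD) = px5 g23 Q11b over Q11a `dist1_ladder_rel_le`; (LIFT-LAD) = px12 g25 (R1) sup edition + Q11a with the lifted rail term;
(SCT-c) = px13 g26 CURL-AVG (✓`…CovWalkSumStokes` + B∕C: diluted lattice-Stokes transport of relative plaquette sups).

INHABITATION (★★OWNER RULING №100): LAW-FREE — real inequalities between sup sizes of descended chord fields of one pair of configurations; no fibre law, no score, no integrability.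

HONEST SCOPE.  Finite-sum algebra over ✓p829725 by name; nothing of Bałaban's analysis is asserted or proved ([Balaban1985Averaging] Prop. 4 (128)–(135) p.37–38 is the printed SUP recursion
this architecture transcribes); (TOP-LAD), (LIFT-LAD), (SCT-c), (ST), LOC, TAYLOR♭_q, AVG₂♭-ax_q, (D-ax), h3 HYPOTHESES; GAP♯∘ (`stub_uniformFibreGapOrbit`, registry 3732b7df UNTOUCHED),
S2β, the five registered stubs (0∕5), 20520, 19936, 19200, `YM3TorusSU2` are NOT proved; rung R3 — NOT d = 4, NOT infinite volume, NOT a mass gap, NOT Clay; the Yang–Mills mass gap is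
NOT proved.
-/

set_option autoImplicit false

noncomputable section

open scoped Matrix.Norms.L2Operator Topology RealInnerProductSpace Quaternion
open Set Function
open Literature.MathematicalPhysics.QuantumLattice (su2Quat)
open Literature.MathematicalPhysics.QuantumFieldTheory.Balaban1983to89
open Literature.MathematicalPhysics.QuantumFieldTheory.Balaban1983to89.T3ContinuumYM3Torus
open Literature.MathematicalPhysics.QuantumFieldTheory.Balaban1983to89.T3UnitLawDensityEML (ℰp)
open Literature.MathematicalPhysics.QuantumFieldTheory.Balaban1983to89.T3UnitScaleTilt
open Literature.MathematicalPhysics.QuantumFieldTheory.Balaban1983to89.T3TiltDescent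
open Literature.MathematicalPhysics.QuantumFieldTheory.Balaban1983to89.T3LevelShift
open Literature.MathematicalPhysics.QuantumFieldTheory.Balaban1983to89.ExpMeanLog (deltaSU)
open Literature.MathematicalPhysics.QuantumFieldTheory.Balaban1983to89.T4HaarSU2ExpChart (expPoint)
open Literature.MathematicalPhysics.QuantumFieldTheory.Balaban1983to89.T4ExpWindowSmallField (imVec logVec)
open Literature.MathematicalPhysics.QuantumFieldTheory.Balaban1983to89.T4Continuum

namespace Summit.QuantumFields.YangMills.Theorems.FluctuationComparisonRegPrIntLS2BetaSupTowerOfLiftLadder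

variable {F : T3Family}

/-! ## §1 The real-sequence lemma: an `L^t`-weighted sum under a contraction-plus-source recursion -/

section Real

/-- ★ **GEOMETRIC ABSORPTION**: if `0 ≤ a_t`, `a₀ ≤ c₀`, `a_{t+1} ≤ A·a_t + c_{t+1}` for `t + 1 < k`, `0 ≤ A`, `0 ≤ L` and `A·L ≤ ½`, then `Σ_{t<k} L^t·a_t ≤ 2·Σ_{t<k} L^t·c_t`
(shift the recursion under the weights: `Σ L^t a_t ≤ Σ L^t c_t + A·L·Σ L^t a_t`). [cite: Balaban1985Averaging, (128)-(133) pp.37-38 (the printed sup recursion's arithmetic)] -/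
theorem weighted_sum_le_of_recursion (k : ℕ) {L A : ℝ} (hL : 0 ≤ L) (hA : 0 ≤ A) (hAL : A * L ≤ 1 / 2) (a c : ℕ → ℝ)
    (ha : ∀ t, 0 ≤ a t) (h0 : 0 < k → a 0 ≤ c 0) (hrec : ∀ t, t + 1 < k → a (t + 1) ≤ A * a t + c (t + 1)) :
    ∑ t ∈ Finset.range k, L ^ t * a t ≤ 2 * ∑ t ∈ Finset.range k, L ^ t * c t := by
  rcases Nat.eq_zero_or_pos k with hk | hk
  · subst hk; simp
  obtain ⟨k', rfl⟩ : ∃ k', k = k' + 1 := ⟨k - 1, by omega⟩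
  -- split off the `t = 0` terms and shift
  have hS : ∑ t ∈ Finset.range (k' + 1), L ^ t * a t = a 0 + ∑ t ∈ Finset.range k', L ^ (t + 1) * a (t + 1) := by
    rw [Finset.sum_range_succ', pow_zero, one_mul, add_comm]
  have hC : ∑ t ∈ Finset.range (k' + 1), L ^ t * c t = c 0 + ∑ t ∈ Finset.range k', L ^ (t + 1) * c (t + 1) := by
    rw [Finset.sum_range_succ', pow_zero, one_mul, add_comm]
  -- the shifted sum under the recursion
  have hshift : ∑ t ∈ Finset.range k', L ^ (t + 1) * a (t + 1) ≤
      ∑ t ∈ Finset.range k', L ^ (t + 1) * c (t + 1) + A * L * ∑ t ∈ Finset.range k', L ^ t * a t := by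
    rw [Finset.mul_sum, ← Finset.sum_add_distrib]
    refine Finset.sum_le_sum fun t ht => ?_
    rw [Finset.mem_range] at ht
    have h1 := hrec t (by omega)
    have hLt : 0 ≤ L ^ (t + 1) := pow_nonneg hL _
    calc L ^ (t + 1) * a (t + 1) ≤ L ^ (t + 1) * (A * a t + c (t + 1)) := mul_le_mul_of_nonneg_left h1 hLt
      _ = L ^ (t + 1) * c (t + 1) + A * L * (L ^ t * a t) := by ring
  -- the partial sum is below the full one
  have hpart : ∑ t ∈ Finset.range k', L ^ t * a t ≤ ∑ t ∈ Finset.range (k' + 1), L ^ t * a t := by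
    rw [Finset.sum_range_succ]
    have : 0 ≤ L ^ k' * a k' := mul_nonneg (pow_nonneg hL _) (ha _)
    linarith
  have hfull0 : 0 ≤ ∑ t ∈ Finset.range (k' + 1), L ^ t * a t := Finset.sum_nonneg fun t _ => mul_nonneg (pow_nonneg hL _) (ha _)
  have hAL0 : 0 ≤ A * L := mul_nonneg hA hL
  have h00 := h0 hk
  -- absorb
  have key : ∑ t ∈ Finset.range (k' + 1), L ^ t * a t ≤
      ∑ t ∈ Finset.range (k' + 1), L ^ t * c t + (1 / 2) * ∑ t ∈ Finset.range (k' + 1), L ^ t * a t := by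
    have h2 : A * L * ∑ t ∈ Finset.range k', L ^ t * a t ≤ (1 / 2) * ∑ t ∈ Finset.range (k' + 1), L ^ t * a t := by
      calc A * L * ∑ t ∈ Finset.range k', L ^ t * a t ≤ A * L * ∑ t ∈ Finset.range (k' + 1), L ^ t * a t := mul_le_mul_of_nonneg_left hpart hAL0
        _ ≤ (1 / 2) * ∑ t ∈ Finset.range (k' + 1), L ^ t * a t := mul_le_mul_of_nonneg_right hAL hfull0
    linarith [hS, hC, hshift, h2, h00]
  linarith

end Real

/-! ## §2 (ST) at fixed data from (TOP-LAD) ∧ (LIFT-LAD) ∧ (SCT-c) -/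

section Fixed

/-- ★★★ **THE SUP TOWER BUDGET (ST) FROM THE LIFT-LADDER RECURSION, AT FIXED DATA** (`J ≤ K`, `U₀`, `ζ`, `θ`; no guards needed): with `a_t` the (ST) summands (the Pi-sup of the
level-`(J+t+1)` log-chord field of the pair `(expPoint ζ • U₀, U₀)` truncated to `READ_t(B)`, summed over the coarsest bonds `B`) and ANY `c : ℕ → ℝ`:
(TOP-LAD) `a₀ ≤ c₀`, (LIFT-LAD) `a_{t+1} ≤ A·a_t + c_{t+1}` (`0 ≤ A`, `A·L ≤ ½`), (SCT-c) `Σ_{t<K−J} L^t·c_t ≤ C_c·e^{c_c·Σθ}·(N⁻¹d² + N·REL)` ⟹ (ST) with `(2·C_c, c_c)` — the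
conclusion is ✓p829725 `local_of_supTower`'s hypothesis `hST` VERBATIM. [cite: Balaban1985Averaging, Prop. 4 (128)-(135) p.37-38; Balaban1987RG1, (0.11) p.253; Balaban1985UV3, (7) p.257] -/
theorem supTower_of_liftLadder {J K : ℕ} (hJK : J ≤ K) (θ : ℕ → ℝ) (U₀ : GaugeField (F.P K) 0 (Matrix.specialUnitaryGroup (Fin 2) ℂ)) (ζ : PBond (F.P K) 0 → EuclideanSpace ℝ (Fin 3))
    {A C_c : ℝ} (c_c : ℝ) (hA : 0 ≤ A) (hAL : A * (F.L : ℝ) ≤ 1 / 2) (c : ℕ → ℝ)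
    (hTOP : ∀ h0 : 0 < K - J, (fun (t : ℕ) (ht : t < K - J) => ∑ B : PBond (F.P J) 0,
            ‖(fun ℓ' : PBond (F.P (J + (t + 1))) 0 =>
              if ∃ b : PBond (F.P (J + t)) 0,
                ((B14.Eq22Determines.blockIter (J + t - J) b.src = (bondShift (F.sitesPerDir_eq (m := F.m) (K := J) (j := 0) (m' := F.m) (K' := J + t) (j' := J + t - J) (by omega)) B).src ∨ B14.Eq22Determines.blockIter (J + t - J) b.src = (bondShift (F.sitesPerDir_eq (m := F.m) (K := J) (j := 0) (m' := F.m) (K' := J + t) (j' := J + t - J) (by omega)) B).tgt) ∧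
                (B14.Eq22Determines.blockIter (J + t - J) b.tgt = (bondShift (F.sitesPerDir_eq (m := F.m) (K := J) (j := 0) (m' := F.m) (K' := J + t) (j' := J + t - J) (by omega)) B).src ∨ B14.Eq22Determines.blockIter (J + t - J) b.tgt = (bondShift (F.sitesPerDir_eq (m := F.m) (K := J) (j := 0) (m' := F.m) (K' := J + t) (j' := J + t - J) (by omega)) B).tgt)) ∧
                (blockOf ℓ'.src = (bondShift (F.sitesPerDir_eq (m := F.m) (K := J + t) (j := 0) (m' := F.m) (K' := J + t + 1) (j' := 1) (by omega)) b).src ∨ blockOf ℓ'.src = (bondShift (F.sitesPerDir_eq (m := F.m) (K := J + t) (j := 0) (m' := F.m) (K' := J + t + 1) (j' := 1) (by omega)) b).tgt)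
              then logVec (su2Quat (descendTo F ℰp (J + (t + 1)) K (by omega) (fun ℓ => expPoint (ζ ℓ) * U₀ ℓ : GaugeField (F.P K) 0 (Matrix.specialUnitaryGroup (Fin 2) ℂ)) ℓ' * (descendTo F ℰp (J + (t + 1)) K (by omega) U₀ ℓ')⁻¹)) else 0)‖ ^ 2) 0 h0 ≤ c 0)
    (hREC : ∀ (t : ℕ) (ht1 : t + 1 < K - J),
      (fun (t : ℕ) (ht : t < K - J) => ∑ B : PBond (F.P J) 0,
            ‖(fun ℓ' : PBond (F.P (J + (t + 1))) 0 =>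
              if ∃ b : PBond (F.P (J + t)) 0,
                ((B14.Eq22Determines.blockIter (J + t - J) b.src = (bondShift (F.sitesPerDir_eq (m := F.m) (K := J) (j := 0) (m' := F.m) (K' := J + t) (j' := J + t - J) (by omega)) B).src ∨ B14.Eq22Determines.blockIter (J + t - J) b.src = (bondShift (F.sitesPerDir_eq (m := F.m) (K := J) (j := 0) (m' := F.m) (K' := J + t) (j' := J + t - J) (by omega)) B).tgt) ∧
                (B14.Eq22Determines.blockIter (J + t - J) b.tgt = (bondShift (F.sitesPerDir_eq (m := F.m) (K := J) (j := 0) (m' := F.m) (K' := J + t) (j' := J + t - J) (by omega)) B).src ∨ B14.Eq22Determines.blockIter (J + t - J) b.tgt = (bondShift (F.sitesPerDir_eq (m := F.m) (K := J) (j := 0) (m' := F.m) (K' := J + t) (j' := J + t - J) (by omega)) B).tgt)) ∧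
                (blockOf ℓ'.src = (bondShift (F.sitesPerDir_eq (m := F.m) (K := J + t) (j := 0) (m' := F.m) (K' := J + t + 1) (j' := 1) (by omega)) b).src ∨ blockOf ℓ'.src = (bondShift (F.sitesPerDir_eq (m := F.m) (K := J + t) (j := 0) (m' := F.m) (K' := J + t + 1) (j' := 1) (by omega)) b).tgt)
              then logVec (su2Quat (descendTo F ℰp (J + (t + 1)) K (by omega) (fun ℓ => expPoint (ζ ℓ) * U₀ ℓ : GaugeField (F.P K) 0 (Matrix.specialUnitaryGroup (Fin 2) ℂ)) ℓ' * (descendTo F ℰp (J + (t + 1)) K (by omega) U₀ ℓ')⁻¹)) else 0)‖ ^ 2) (t + 1) ht1 ≤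
        A * (fun (t : ℕ) (ht : t < K - J) => ∑ B : PBond (F.P J) 0,
            ‖(fun ℓ' : PBond (F.P (J + (t + 1))) 0 =>
              if ∃ b : PBond (F.P (J + t)) 0,
                ((B14.Eq22Determines.blockIter (J + t - J) b.src = (bondShift (F.sitesPerDir_eq (m := F.m) (K := J) (j := 0) (m' := F.m) (K' := J + t) (j' := J + t - J) (by omega)) B).src ∨ B14.Eq22Determines.blockIter (J + t - J) b.src = (bondShift (F.sitesPerDir_eq (m := F.m) (K := J) (j := 0) (m' := F.m) (K' := J + t) (j' := J + t - J) (by omega)) B).tgt) ∧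
                (B14.Eq22Determines.blockIter (J + t - J) b.tgt = (bondShift (F.sitesPerDir_eq (m := F.m) (K := J) (j := 0) (m' := F.m) (K' := J + t) (j' := J + t - J) (by omega)) B).src ∨ B14.Eq22Determines.blockIter (J + t - J) b.tgt = (bondShift (F.sitesPerDir_eq (m := F.m) (K := J) (j := 0) (m' := F.m) (K' := J + t) (j' := J + t - J) (by omega)) B).tgt)) ∧
                (blockOf ℓ'.src = (bondShift (F.sitesPerDir_eq (m := F.m) (K := J + t) (j := 0) (m' := F.m) (K' := J + t + 1) (j' := 1) (by omega)) b).src ∨ blockOf ℓ'.src = (bondShift (F.sitesPerDir_eq (m := F.m) (K := J + t) (j := 0) (m' := F.m) (K' := J + t + 1) (j' := 1) (by omega)) b).tgt)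
              then logVec (su2Quat (descendTo F ℰp (J + (t + 1)) K (by omega) (fun ℓ => expPoint (ζ ℓ) * U₀ ℓ : GaugeField (F.P K) 0 (Matrix.specialUnitaryGroup (Fin 2) ℂ)) ℓ' * (descendTo F ℰp (J + (t + 1)) K (by omega) U₀ ℓ')⁻¹)) else 0)‖ ^ 2) t (Nat.lt_of_succ_lt ht1) + c (t + 1))
    (hSCT : ∑ t ∈ Finset.range (K - J), (F.L : ℝ) ^ t * c t ≤ C_c * Real.exp (c_c * ∑ i ∈ Finset.range (K - J), (((5 * F.L : ℕ) : ℝ) ^ 2 / 4) * θ (K - i)) * (((F.L : ℝ)⁻¹) ^ (K - J) * ∑ ℓ : PBond (F.P K) 0, ‖ζ ℓ‖ ^ 2 +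
                (F.L : ℝ) ^ (K - J) * ∑ p : Plaq (F.P K) 0,
                  (1 - reTr ((GaugeField.plaqHol U₀ p)⁻¹ * GaugeField.plaqHol (fun ℓ => expPoint (ζ ℓ) * U₀ ℓ : GaugeField (F.P K) 0 (Matrix.specialUnitaryGroup (Fin 2) ℂ)) p)))) :
    ∑ t ∈ Finset.range (K - J), (if ht : t < K - J then
          (F.L : ℝ) ^ t * ∑ B : PBond (F.P J) 0,
            ‖(fun ℓ' : PBond (F.P (J + (t + 1))) 0 =>
              if ∃ b : PBond (F.P (J + t)) 0,
                ((B14.Eq22Determines.blockIter (J + t - J) b.src = (bondShift (F.sitesPerDir_eq (m := F.m) (K := J) (j := 0) (m' := F.m) (K' := J + t) (j' := J + t - J) (by omega)) B).src ∨ B14.Eq22Determines.blockIter (J + t - J) b.src = (bondShift (F.sitesPerDir_eq (m := F.m) (K := J) (j := 0) (m' := F.m) (K' := J + t) (j' := J + t - J) (by omega)) B).tgt) ∧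
                (B14.Eq22Determines.blockIter (J + t - J) b.tgt = (bondShift (F.sitesPerDir_eq (m := F.m) (K := J) (j := 0) (m' := F.m) (K' := J + t) (j' := J + t - J) (by omega)) B).src ∨ B14.Eq22Determines.blockIter (J + t - J) b.tgt = (bondShift (F.sitesPerDir_eq (m := F.m) (K := J) (j := 0) (m' := F.m) (K' := J + t) (j' := J + t - J) (by omega)) B).tgt)) ∧
                (blockOf ℓ'.src = (bondShift (F.sitesPerDir_eq (m := F.m) (K := J + t) (j := 0) (m' := F.m) (K' := J + t + 1) (j' := 1) (by omega)) b).src ∨ blockOf ℓ'.src = (bondShift (F.sitesPerDir_eq (m := F.m) (K := J + t) (j := 0) (m' := F.m) (K' := J + t + 1) (j' := 1) (by omega)) b).tgt)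
              then logVec (su2Quat (descendTo F ℰp (J + (t + 1)) K (by omega) (fun ℓ => expPoint (ζ ℓ) * U₀ ℓ : GaugeField (F.P K) 0 (Matrix.specialUnitaryGroup (Fin 2) ℂ)) ℓ' * (descendTo F ℰp (J + (t + 1)) K (by omega) U₀ ℓ')⁻¹)) else 0)‖ ^ 2
        else 0) ≤
      (2 * C_c) * Real.exp (c_c * ∑ i ∈ Finset.range (K - J), (((5 * F.L : ℕ) : ℝ) ^ 2 / 4) * θ (K - i)) * (((F.L : ℝ)⁻¹) ^ (K - J) * ∑ ℓ : PBond (F.P K) 0, ‖ζ ℓ‖ ^ 2 +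
                (F.L : ℝ) ^ (K - J) * ∑ p : Plaq (F.P K) 0,
                  (1 - reTr ((GaugeField.plaqHol U₀ p)⁻¹ * GaugeField.plaqHol (fun ℓ => expPoint (ζ ℓ) * U₀ ℓ : GaugeField (F.P K) 0 (Matrix.specialUnitaryGroup (Fin 2) ℂ)) p))) := by
  have _hJK := hJK
  -- the (ST) summands as a sequence
  set E : (t : ℕ) → t < K - J → ℝ := fun (t : ℕ) (ht : t < K - J) => ∑ B : PBond (F.P J) 0,
            ‖(fun ℓ' : PBond (F.P (J + (t + 1))) 0 =>
              if ∃ b : PBond (F.P (J + t)) 0,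
                ((B14.Eq22Determines.blockIter (J + t - J) b.src = (bondShift (F.sitesPerDir_eq (m := F.m) (K := J) (j := 0) (m' := F.m) (K' := J + t) (j' := J + t - J) (by omega)) B).src ∨ B14.Eq22Determines.blockIter (J + t - J) b.src = (bondShift (F.sitesPerDir_eq (m := F.m) (K := J) (j := 0) (m' := F.m) (K' := J + t) (j' := J + t - J) (by omega)) B).tgt) ∧
                (B14.Eq22Determines.blockIter (J + t - J) b.tgt = (bondShift (F.sitesPerDir_eq (m := F.m) (K := J) (j := 0) (m' := F.m) (K' := J + t) (j' := J + t - J) (by omega)) B).src ∨ B14.Eq22Determines.blockIter (J + t - J) b.tgt = (bondShift (F.sitesPerDir_eq (m := F.m) (K := J) (j := 0) (m' := F.m) (K' := J + t) (j' := J + t - J) (by omega)) B).tgt)) ∧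
                (blockOf ℓ'.src = (bondShift (F.sitesPerDir_eq (m := F.m) (K := J + t) (j := 0) (m' := F.m) (K' := J + t + 1) (j' := 1) (by omega)) b).src ∨ blockOf ℓ'.src = (bondShift (F.sitesPerDir_eq (m := F.m) (K := J + t) (j := 0) (m' := F.m) (K' := J + t + 1) (j' := 1) (by omega)) b).tgt)
              then logVec (su2Quat (descendTo F ℰp (J + (t + 1)) K (by omega) (fun ℓ => expPoint (ζ ℓ) * U₀ ℓ : GaugeField (F.P K) 0 (Matrix.specialUnitaryGroup (Fin 2) ℂ)) ℓ' * (descendTo F ℰp (J + (t + 1)) K (by omega) U₀ ℓ')⁻¹)) else 0)‖ ^ 2 with hEdef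
  set a : ℕ → ℝ := fun t => if ht : t < K - J then E t ht else 0 with hadef
  have ha0 : ∀ t, 0 ≤ a t := fun t => by
    rw [hadef]; dsimp only
    split_ifs with ht
    · rw [hEdef]; exact Finset.sum_nonneg fun B _ => by positivity
    · exact le_rfl
  have hL0 : (0 : ℝ) ≤ (F.L : ℝ) := Nat.cast_nonneg _
  -- the left side is `Σ L^t a_t`
  have hlhs : ∑ t ∈ Finset.range (K - J), (if ht : t < K - J then
          (F.L : ℝ) ^ t * ∑ B : PBond (F.P J) 0,
            ‖(fun ℓ' : PBond (F.P (J + (t + 1))) 0 =>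
              if ∃ b : PBond (F.P (J + t)) 0,
                ((B14.Eq22Determines.blockIter (J + t - J) b.src = (bondShift (F.sitesPerDir_eq (m := F.m) (K := J) (j := 0) (m' := F.m) (K' := J + t) (j' := J + t - J) (by omega)) B).src ∨ B14.Eq22Determines.blockIter (J + t - J) b.src = (bondShift (F.sitesPerDir_eq (m := F.m) (K := J) (j := 0) (m' := F.m) (K' := J + t) (j' := J + t - J) (by omega)) B).tgt) ∧
                (B14.Eq22Determines.blockIter (J + t - J) b.tgt = (bondShift (F.sitesPerDir_eq (m := F.m) (K := J) (j := 0) (m' := F.m) (K' := J + t) (j' := J + t - J) (by omega)) B).src ∨ B14.Eq22Determines.blockIter (J + t - J) b.tgt = (bondShift (F.sitesPerDir_eq (m := F.m) (K := J) (j := 0) (m' := F.m) (K' := J + t) (j' := J + t - J) (by omega)) B).tgt)) ∧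
                (blockOf ℓ'.src = (bondShift (F.sitesPerDir_eq (m := F.m) (K := J + t) (j := 0) (m' := F.m) (K' := J + t + 1) (j' := 1) (by omega)) b).src ∨ blockOf ℓ'.src = (bondShift (F.sitesPerDir_eq (m := F.m) (K := J + t) (j := 0) (m' := F.m) (K' := J + t + 1) (j' := 1) (by omega)) b).tgt)
              then logVec (su2Quat (descendTo F ℰp (J + (t + 1)) K (by omega) (fun ℓ => expPoint (ζ ℓ) * U₀ ℓ : GaugeField (F.P K) 0 (Matrix.specialUnitaryGroup (Fin 2) ℂ)) ℓ' * (descendTo F ℰp (J + (t + 1)) K (by omega) U₀ ℓ')⁻¹)) else 0)‖ ^ 2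
        else 0) = ∑ t ∈ Finset.range (K - J), (F.L : ℝ) ^ t * a t := by
    refine Finset.sum_congr rfl fun t ht => ?_
    rw [Finset.mem_range] at ht
    rw [hadef]; dsimp only
    rw [dif_pos ht, dif_pos ht]
  rw [hlhs]
  have h0 : 0 < K - J → a 0 ≤ c 0 := fun hk => by
    rw [hadef]; dsimp only; rw [dif_pos hk]; exact hTOP hk
  have hrec : ∀ t, t + 1 < K - J → a (t + 1) ≤ A * a t + c (t + 1) := fun t ht1 => by
    rw [hadef]; dsimp only
    rw [dif_pos ht1, dif_pos (Nat.lt_of_succ_lt ht1)]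
    exact hREC t ht1
  have hw := weighted_sum_le_of_recursion (K - J) hL0 hA hAL a c ha0 h0 hrec
  refine hw.trans ?_
  have : 2 * ∑ t ∈ Finset.range (K - J), (F.L : ℝ) ^ t * c t ≤ 2 * (C_c * Real.exp (c_c * ∑ i ∈ Finset.range (K - J), (((5 * F.L : ℕ) : ℝ) ^ 2 / 4) * θ (K - i)) * (((F.L : ℝ)⁻¹) ^ (K - J) * ∑ ℓ : PBond (F.P K) 0, ‖ζ ℓ‖ ^ 2 +
                (F.L : ℝ) ^ (K - J) * ∑ p : Plaq (F.P K) 0,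
                  (1 - reTr ((GaugeField.plaqHol U₀ p)⁻¹ * GaugeField.plaqHol (fun ℓ => expPoint (ζ ℓ) * U₀ ℓ : GaugeField (F.P K) 0 (Matrix.specialUnitaryGroup (Fin 2) ℂ)) p)))) :=
    mul_le_mul_of_nonneg_left hSCT zero_le_two
  linarith

end Fixed

/-! ## §3 The letter: ✓p829725's `hSTL` VERBATIM from the bundled LIFT-LADDER letter in LOC's prefix -/

section Letter

/-- ★★★ **(ST) LETTER ⟸ LIFT-LADDER LETTER** (same prefix as LOC ∕ `hSTL`: guards, `‖ζ ℓ‖ ≤ π`, partner `∈ histGood`, `Ax`): the conclusion is ✓p829725 `loc_of_supTowerLetter`'s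
hypothesis `hSTL` VERBATIM, so `loc_of_supTowerLetter G Ax (supTowerLetter_of_liftLadderLetter G Ax hLL)` : LOC and, with px16's knit, GAP♯∘ ⟸ {h3, (D-stage)×2, LIFT-LADDER}.
[cite: Balaban1985Averaging, Prop. 4 (128)-(135) p.37-38, (148)-(157) p.40-42; Balaban1987RG1, (0.4), (0.11) p.253; Balaban1985UV3, (7) p.257] -/
theorem supTowerLetter_of_liftLadderLetter
    (G : (F : T3Family) → (J : ℕ) → GaugeField (F.P J) 0 (Matrix.specialUnitaryGroup (Fin 2) ℂ) → Prop)
    (Ax : (F : T3Family) → (J K : ℕ) → (hJK : J ≤ K) → GaugeField (F.P K) 0 (Matrix.specialUnitaryGroup (Fin 2) ℂ) →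
      GaugeField (F.P K) 0 (Matrix.specialUnitaryGroup (Fin 2) ℂ) → Prop)
    (hLL : ∀ (L : ℕ), 1 < L → ∃ A : ℝ, 0 ≤ A ∧ A * (L : ℝ) ≤ 1 / 2 ∧ ∃ C_c : ℝ, 0 ≤ C_c ∧ ∃ c_c : ℝ, 0 ≤ c_c ∧ ∀ (F : T3Family), F.L = L →
      ∀ (J K : ℕ) (hJK : J ≤ K) (θ : ℕ → ℝ), (∀ i, 0 ≤ θ i) → ∀ (α : ℝ), (∀ i, J < i → i ≤ K → (((5 * F.L : ℕ) : ℝ) ^ 2 / 4) * θ i ≤ α) →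
        α ≤ 1 / 24 → α < deltaSU (Fin 2) → 157 * α < ((F.L : ℝ) ^ 2)⁻¹ →
        ∀ U₀ : GaugeField (F.P K) 0 (Matrix.specialUnitaryGroup (Fin 2) ℂ), U₀ ∈ histGood F ℰp θ K J →
        ∀ ζ : PBond (F.P K) 0 → EuclideanSpace ℝ (Fin 3), (∀ ℓ, ‖ζ ℓ‖ ≤ Real.pi) →
          (fun ℓ => expPoint (ζ ℓ) * U₀ ℓ : GaugeField (F.P K) 0 (Matrix.specialUnitaryGroup (Fin 2) ℂ)) ∈ histGood F ℰp θ K J →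
            Ax F J K hJK (fun ℓ => expPoint (ζ ℓ) * U₀ ℓ) U₀ →
            ∃ c : ℕ → ℝ,
            (∀ h0 : 0 < K - J, (fun (t : ℕ) (ht : t < K - J) => ∑ B : PBond (F.P J) 0,
            ‖(fun ℓ' : PBond (F.P (J + (t + 1))) 0 =>
              if ∃ b : PBond (F.P (J + t)) 0,
                ((B14.Eq22Determines.blockIter (J + t - J) b.src = (bondShift (F.sitesPerDir_eq (m := F.m) (K := J) (j := 0) (m' := F.m) (K' := J + t) (j' := J + t - J) (by omega)) B).src ∨ B14.Eq22Determines.blockIter (J + t - J) b.src = (bondShift (F.sitesPerDir_eq (m := F.m) (K := J) (j := 0) (m' := F.m) (K' := J + t) (j' := J + t - J) (by omega)) B).tgt) ∧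
                (B14.Eq22Determines.blockIter (J + t - J) b.tgt = (bondShift (F.sitesPerDir_eq (m := F.m) (K := J) (j := 0) (m' := F.m) (K' := J + t) (j' := J + t - J) (by omega)) B).src ∨ B14.Eq22Determines.blockIter (J + t - J) b.tgt = (bondShift (F.sitesPerDir_eq (m := F.m) (K := J) (j := 0) (m' := F.m) (K' := J + t) (j' := J + t - J) (by omega)) B).tgt)) ∧
                (blockOf ℓ'.src = (bondShift (F.sitesPerDir_eq (m := F.m) (K := J + t) (j := 0) (m' := F.m) (K' := J + t + 1) (j' := 1) (by omega)) b).src ∨ blockOf ℓ'.src = (bondShift (F.sitesPerDir_eq (m := F.m) (K := J + t) (j := 0) (m' := F.m) (K' := J + t + 1) (j' := 1) (by omega)) b).tgt)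
              then logVec (su2Quat (descendTo F ℰp (J + (t + 1)) K (by omega) (fun ℓ => expPoint (ζ ℓ) * U₀ ℓ : GaugeField (F.P K) 0 (Matrix.specialUnitaryGroup (Fin 2) ℂ)) ℓ' * (descendTo F ℰp (J + (t + 1)) K (by omega) U₀ ℓ')⁻¹)) else 0)‖ ^ 2) 0 h0 ≤ c 0) ∧
            (∀ (t : ℕ) (ht1 : t + 1 < K - J),
              (fun (t : ℕ) (ht : t < K - J) => ∑ B : PBond (F.P J) 0,
            ‖(fun ℓ' : PBond (F.P (J + (t + 1))) 0 =>
              if ∃ b : PBond (F.P (J + t)) 0,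
                ((B14.Eq22Determines.blockIter (J + t - J) b.src = (bondShift (F.sitesPerDir_eq (m := F.m) (K := J) (j := 0) (m' := F.m) (K' := J + t) (j' := J + t - J) (by omega)) B).src ∨ B14.Eq22Determines.blockIter (J + t - J) b.src = (bondShift (F.sitesPerDir_eq (m := F.m) (K := J) (j := 0) (m' := F.m) (K' := J + t) (j' := J + t - J) (by omega)) B).tgt) ∧
                (B14.Eq22Determines.blockIter (J + t - J) b.tgt = (bondShift (F.sitesPerDir_eq (m := F.m) (K := J) (j := 0) (m' := F.m) (K' := J + t) (j' := J + t - J) (by omega)) B).src ∨ B14.Eq22Determines.blockIter (J + t - J) b.tgt = (bondShift (F.sitesPerDir_eq (m := F.m) (K := J) (j := 0) (m' := F.m) (K' := J + t) (j' := J + t - J) (by omega)) B).tgt)) ∧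
                (blockOf ℓ'.src = (bondShift (F.sitesPerDir_eq (m := F.m) (K := J + t) (j := 0) (m' := F.m) (K' := J + t + 1) (j' := 1) (by omega)) b).src ∨ blockOf ℓ'.src = (bondShift (F.sitesPerDir_eq (m := F.m) (K := J + t) (j := 0) (m' := F.m) (K' := J + t + 1) (j' := 1) (by omega)) b).tgt)
              then logVec (su2Quat (descendTo F ℰp (J + (t + 1)) K (by omega) (fun ℓ => expPoint (ζ ℓ) * U₀ ℓ : GaugeField (F.P K) 0 (Matrix.specialUnitaryGroup (Fin 2) ℂ)) ℓ' * (descendTo F ℰp (J + (t + 1)) K (by omega) U₀ ℓ')⁻¹)) else 0)‖ ^ 2) (t + 1) ht1 ≤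
                A * (fun (t : ℕ) (ht : t < K - J) => ∑ B : PBond (F.P J) 0,
            ‖(fun ℓ' : PBond (F.P (J + (t + 1))) 0 =>
              if ∃ b : PBond (F.P (J + t)) 0,
                ((B14.Eq22Determines.blockIter (J + t - J) b.src = (bondShift (F.sitesPerDir_eq (m := F.m) (K := J) (j := 0) (m' := F.m) (K' := J + t) (j' := J + t - J) (by omega)) B).src ∨ B14.Eq22Determines.blockIter (J + t - J) b.src = (bondShift (F.sitesPerDir_eq (m := F.m) (K := J) (j := 0) (m' := F.m) (K' := J + t) (j' := J + t - J) (by omega)) B).tgt) ∧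
                (B14.Eq22Determines.blockIter (J + t - J) b.tgt = (bondShift (F.sitesPerDir_eq (m := F.m) (K := J) (j := 0) (m' := F.m) (K' := J + t) (j' := J + t - J) (by omega)) B).src ∨ B14.Eq22Determines.blockIter (J + t - J) b.tgt = (bondShift (F.sitesPerDir_eq (m := F.m) (K := J) (j := 0) (m' := F.m) (K' := J + t) (j' := J + t - J) (by omega)) B).tgt)) ∧
                (blockOf ℓ'.src = (bondShift (F.sitesPerDir_eq (m := F.m) (K := J + t) (j := 0) (m' := F.m) (K' := J + t + 1) (j' := 1) (by omega)) b).src ∨ blockOf ℓ'.src = (bondShift (F.sitesPerDir_eq (m := F.m) (K := J + t) (j := 0) (m' := F.m) (K' := J + t + 1) (j' := 1) (by omega)) b).tgt)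
              then logVec (su2Quat (descendTo F ℰp (J + (t + 1)) K (by omega) (fun ℓ => expPoint (ζ ℓ) * U₀ ℓ : GaugeField (F.P K) 0 (Matrix.specialUnitaryGroup (Fin 2) ℂ)) ℓ' * (descendTo F ℰp (J + (t + 1)) K (by omega) U₀ ℓ')⁻¹)) else 0)‖ ^ 2) t (Nat.lt_of_succ_lt ht1) + c (t + 1)) ∧
            ∑ t ∈ Finset.range (K - J), (F.L : ℝ) ^ t * c t ≤ C_c * Real.exp (c_c * ∑ i ∈ Finset.range (K - J), (((5 * F.L : ℕ) : ℝ) ^ 2 / 4) * θ (K - i)) * (((F.L : ℝ)⁻¹) ^ (K - J) * ∑ ℓ : PBond (F.P K) 0, ‖ζ ℓ‖ ^ 2 +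
                (F.L : ℝ) ^ (K - J) * ∑ p : Plaq (F.P K) 0,
                  (1 - reTr ((GaugeField.plaqHol U₀ p)⁻¹ * GaugeField.plaqHol (fun ℓ => expPoint (ζ ℓ) * U₀ ℓ : GaugeField (F.P K) 0 (Matrix.specialUnitaryGroup (Fin 2) ℂ)) p)))) :
    ∀ (L : ℕ), 1 < L → ∃ C_ST : ℝ, 0 ≤ C_ST ∧ ∃ c_ST : ℝ, 0 ≤ c_ST ∧ ∀ (F : T3Family), F.L = L →
      ∀ (J K : ℕ) (hJK : J ≤ K) (θ : ℕ → ℝ), (∀ i, 0 ≤ θ i) → ∀ (α : ℝ), (∀ i, J < i → i ≤ K → (((5 * F.L : ℕ) : ℝ) ^ 2 / 4) * θ i ≤ α) →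
        α ≤ 1 / 24 → α < deltaSU (Fin 2) → 157 * α < ((F.L : ℝ) ^ 2)⁻¹ →
        ∀ U₀ : GaugeField (F.P K) 0 (Matrix.specialUnitaryGroup (Fin 2) ℂ), U₀ ∈ histGood F ℰp θ K J →
        ∀ ζ : PBond (F.P K) 0 → EuclideanSpace ℝ (Fin 3), (∀ ℓ, ‖ζ ℓ‖ ≤ Real.pi) →
          (fun ℓ => expPoint (ζ ℓ) * U₀ ℓ : GaugeField (F.P K) 0 (Matrix.specialUnitaryGroup (Fin 2) ℂ)) ∈ histGood F ℰp θ K J →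
            Ax F J K hJK (fun ℓ => expPoint (ζ ℓ) * U₀ ℓ) U₀ →
            ∑ t ∈ Finset.range (K - J), (if ht : t < K - J then
          (F.L : ℝ) ^ t * ∑ B : PBond (F.P J) 0,
            ‖(fun ℓ' : PBond (F.P (J + (t + 1))) 0 =>
              if ∃ b : PBond (F.P (J + t)) 0,
                ((B14.Eq22Determines.blockIter (J + t - J) b.src = (bondShift (F.sitesPerDir_eq (m := F.m) (K := J) (j := 0) (m' := F.m) (K' := J + t) (j' := J + t - J) (by omega)) B).src ∨ B14.Eq22Determines.blockIter (J + t - J) b.src = (bondShift (F.sitesPerDir_eq (m := F.m) (K := J) (j := 0) (m' := F.m) (K' := J + t) (j' := J + t - J) (by omega)) B).tgt) ∧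
                (B14.Eq22Determines.blockIter (J + t - J) b.tgt = (bondShift (F.sitesPerDir_eq (m := F.m) (K := J) (j := 0) (m' := F.m) (K' := J + t) (j' := J + t - J) (by omega)) B).src ∨ B14.Eq22Determines.blockIter (J + t - J) b.tgt = (bondShift (F.sitesPerDir_eq (m := F.m) (K := J) (j := 0) (m' := F.m) (K' := J + t) (j' := J + t - J) (by omega)) B).tgt)) ∧
                (blockOf ℓ'.src = (bondShift (F.sitesPerDir_eq (m := F.m) (K := J + t) (j := 0) (m' := F.m) (K' := J + t + 1) (j' := 1) (by omega)) b).src ∨ blockOf ℓ'.src = (bondShift (F.sitesPerDir_eq (m := F.m) (K := J + t) (j := 0) (m' := F.m) (K' := J + t + 1) (j' := 1) (by omega)) b).tgt)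
              then logVec (su2Quat (descendTo F ℰp (J + (t + 1)) K (by omega) (fun ℓ => expPoint (ζ ℓ) * U₀ ℓ : GaugeField (F.P K) 0 (Matrix.specialUnitaryGroup (Fin 2) ℂ)) ℓ' * (descendTo F ℰp (J + (t + 1)) K (by omega) U₀ ℓ')⁻¹)) else 0)‖ ^ 2
        else 0) ≤
              C_ST * Real.exp (c_ST * ∑ i ∈ Finset.range (K - J), (((5 * F.L : ℕ) : ℝ) ^ 2 / 4) * θ (K - i)) * (((F.L : ℝ)⁻¹) ^ (K - J) * ∑ ℓ : PBond (F.P K) 0, ‖ζ ℓ‖ ^ 2 +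
                (F.L : ℝ) ^ (K - J) * ∑ p : Plaq (F.P K) 0,
                  (1 - reTr ((GaugeField.plaqHol U₀ p)⁻¹ * GaugeField.plaqHol (fun ℓ => expPoint (ζ ℓ) * U₀ ℓ : GaugeField (F.P K) 0 (Matrix.specialUnitaryGroup (Fin 2) ℂ)) p))) := by
  have _hG := G
  intro L hL
  obtain ⟨A, hA, hAL, C_c, hCc, c_c, hcc, H⟩ := hLL L hL
  refine ⟨2 * C_c, by positivity, c_c, hcc, ?_⟩
  intro F hF J K hJK θ hθ0 α hθα hα24 hαδ hαL U₀ hUg ζ hζ hWg hAx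
  obtain ⟨c, hTOP, hREC, hSCT⟩ := H F hF J K hJK θ hθ0 α hθα hα24 hαδ hαL U₀ hUg ζ hζ hWg hAx
  have hAL' : A * (F.L : ℝ) ≤ 1 / 2 := by rw [hF]; exact hAL
  exact supTower_of_liftLadder (F := F) hJK θ U₀ ζ c_c hA hAL' c hTOP hREC hSCT

end Letter

end Summit.QuantumFields.YangMills.Theorems.FluctuationComparisonRegPrIntLS2BetaSupTowerOfLiftLadder

end
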